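import Literature.NumberTheory.Automorphic.PadicIntermediateFieldUnitBall
import Literature.NumberTheory.EllipticCurves.Skinner2016.HidaCongruentMembers
import Literature.NumberTheory.EllipticCurves.NewformsCoeffFieldHolds
import Mathlib.RingTheory.DedekindDomain.Different
import Mathlib.RingTheory.DedekindDomain.IntegralClosure
import Mathlib.RingTheory.Localization.Module
import Mathlib.RingTheory.FractionalIdeal.Operations
import HarnessLib

/-!
# The ring of integers `𝒪` of a finite extension of `ℚ_p` is a FROBENIUS `ℤ_p`-algebra: a
# `ℤ_p`-linear form `t : 𝒪 → ℤ_p` with mutually `t`-dual `ℤ_p`-bases `(b_i)`, `(b'_i)` of `𝒪`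
# (`a = Σ t(a b'_i) b_i = Σ t(a b_i) b'_i`) — because the inverse different `𝒟⁻¹_{𝒪/ℤ_p}` is principal

Cell `bsd-stepL` (run/shared/lean/pub/bsd-stepL/), typer lane `bsd-stepL-defn-ty1` (g3), for the deciding
stub `stub_roadFF_fittingCongruenceFrameB` of crux `stmt-BirchSwinnertonDyer-20169`
(`IMCDivAtErratumDataAllR`, route ErratumRoadFive). The Summits-side coefficient base change of
Pontryagin duals, `Theorems/ErratumRoadFiveCoeffBaseChangeCharacterModule.lean` (imc-p1 g9, p498960:
`CoeffBaseChange.exists_characterModule_baseChange_equiv`, `…_powerSeries_baseChange_equiv`), takes as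
its ONLY hypothesis "Frobenius data" for the coefficient extension `R → A`: an `R`-linear form
`t : A →ₗ[R] R` and finite families `b b' : ι → A` with `∀ a, a = ∑ i, t (a * b' i) • b i` and
`∀ a, a = ∑ i, t (a * b i) • b' i`. This file PROVES that hypothesis — nothing is assumed, no named fact —
for the extension that occurs there, `ℤ_p → 𝒪_m = GreenbergSelmer.padicCoeffIntegers ι_m` (the coefficient
ring of a Hida member `g_m`, `Skinner2016.HidaCongruentForm`; imc-p1 g9's residual "(Frob)",
HOME/imc-p1/g9/STUB2-RESIDUAL-20169-imc-p1-g9.md), together with the structural facts the same consumer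
named («`𝒪_m` is a PID, finite free and faithful over `ℤ_p`», which the carrier did not yet carry).

THE ARGUMENT (Serre, *Local Fields*, Ch. III §3 with §2 Prop. 4): for `A ⊂ K = Frac A` integrally closed,
`L/K` finite separable, `B` the integral closure of `A` in `L`, the codifferent
`B* = {y ∈ L : Tr(yB) ⊆ A}` ("inverse different") is a fractional ideal of `B` containing `B`, and for an
`A`-basis `(e_i)` of `B` it is the `A`-span of the trace-dual basis `(e_i*)`, `Tr(e_i e_j*) = δ_ij`
(§2 Prop. 4). If `B` is a PRINCIPAL IDEAL DOMAIN then `B* = B·δ'` for some `δ' ∈ L^×`; put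
`t(a) := Tr(δ' a) ∈ A`, `b_i := e_i`, and `b'_i ∈ B` with `e_i* = b'_i δ'`. Then
`t(e_i b'_j) = Tr(e_i e_j*) = δ_ij`, `B = δ'⁻¹B* = ⊕ A b'_i`, and the two expansions are the two
dual-basis expansions `x = Σ Tr(x e_i*) e_i = Σ Tr(x e_i) e_i*` in `L`
(`exists_frobeniusData_of_isPrincipalIdealRing`; Mathlib: `Submodule.traceDual`, `FractionalIdeal.dual`,
`FractionalIdeal.isPrincipal`, `Module.Basis.traceDual`, `Basis.localizationLocalization`).

Applied to `A = ℤ_p`, `L = E ⊂ ℚ̄_p` finite over `ℚ_p`, `B = 𝒪_E = PadicIntermediateField.unitBall p E`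
(the tree's `Literature/NumberTheory/Automorphic/PadicIntermediateFieldUnitBall.lean`: integral closure of
`ℤ_p`, finite free over `ℤ_p`, a local Dedekind domain hence a PID) this gives `exists_frobeniusData_unitBall`;
and transported along the canonical `ℤ_p`-algebra isomorphism
`GreenbergSelmer.padicCoeffIntegers ι ≃ₐ[ℤ_p] unitBall p (padicCoeffField ι)` (same elements of `ℚ̄_p`;
`GreenbergSelmer.exists_algEquiv_unitBall`) it gives, for `K = ℚ_p(ι K_g)` finite over `ℚ_p`:

* `GreenbergSelmer.isPrincipalIdealRing_padicCoeffIntegers`, `…moduleFinite_padicCoeffIntegers`,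
  `…moduleFree_padicCoeffIntegers`, `…algebraMap_padicInt_injective` / `…faithfulSMul_padicInt`
  (the instances imc-p1 g9 asked for, stated as theorems — no instance is declared in this file);
* **`GreenbergSelmer.exists_frobeniusData_padicCoeffIntegers`** — Frobenius data for `ℤ_p → 𝒪`, in the
  exact shape of the consumer's binders `(t, b, b', hb, hb')` with `ι := Fin n`;
* `GreenbergSelmer.finiteDimensional_padicCoeffField` — `ℚ_p(ι K_g)/ℚ_p` is finite when `K_g/ℚ` is (for a
  newform `K_g` is a number field: the tree's theorem `IsNewform0.finiteDimensional_coeffField_holds`,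
  Shimura 1971 Thm. 3.48), whence for a Hida member `D : Skinner2016.HidaCongruentForm W p m`:
  **`D.exists_frobeniusData`**, `D.isPrincipalIdealRing_coeffRing`, `D.moduleFree_coeffRing`,
  `D.moduleFinite_coeffRing`.

THEOREMS ONLY; no definition, no named fact, no `sorry`, no instance.

## References

* J.-P. Serre, *Local Fields*, GTM 67 (1979), Ch. III §3 ("codifferent (or inverse different) … a
  fractional ideal of `L` with respect to `B`", p. 50) and §2 Prop. 4 (dual basis `T(e_i, e_j*) = δ_ij`).
  [SerreLocalFields1979]
* J. Neukirch, *Algebraic Number Theory* (1999), Ch. II (4.8), Ch. III §2. [NeukirchANT1999]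
* C. Skinner, Pacific J. Math. 283 (2016), §2.6 ("`𝒪` the ring of integers of `L`"). [Skinner2016PacificMC]
* Tree: `PadicIntermediateFieldUnitBall.lean`, `GreenbergSelmerNewformDatum.lean` (`padicCoeffIntegers ι`),
  `Skinner2016/HidaCongruentMembers.lean` (`Algebra ℤ_[p] (padicCoeffIntegers ι)`, `HidaCongruentForm`),
  Summits consumer `Theorems/ErratumRoadFiveCoeffBaseChangeCharacterModule.lean`.
-/

noncomputable section

open scoped nonZeroDivisors
open Module Algebra

namespace Literature.NumberTheory.EllipticCurves

/-! ### §1. A PID integral closure is a Frobenius algebra (dual bases from a generator of the codifferent) -/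

/-- **Frobenius data for a finite free extension `A ⊂ B` of domains with `B` a principal ideal domain**
(`A` integrally closed with fraction field `K`, `L/K` finite separable, `B` the integral closure of `A` in
`L`, free of finite rank over `A`): there are an `A`-linear form `t : B → A` and finite families
`b, b' : Fin n → B` with `a = ∑ i, t (a * b' i) • b i` and `a = ∑ i, t (a * b i) • b' i` for every `a ∈ B`.
Proof: the codifferent `B* = {y : Tr(yB) ⊆ A}` is a fractional ideal of `B` (Serre III §3), principal since
`B` is a PID, `B* = Bδ'`; `t := Tr(δ' ·)`, `b :=` an `A`-basis `(e_i)` of `B`, `b'_i := e_i*/δ' ∈ B` where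
`(e_i*)` is the trace-dual basis, which spans `B*` over `A` (Serre III §2 Prop. 4); the identities are the
two dual-basis expansions in `L`. [cite: SerreLocalFields1979, Ch. III §3 (p. 50) and §2 Prop. 4] -/
theorem exists_frobeniusData_of_isPrincipalIdealRing
    (A K L B : Type*) [CommRing A] [IsDomain A] [IsIntegrallyClosed A] [Field K] [Algebra A K]
    [IsFractionRing A K] [CommRing B] [IsDomain B] [IsPrincipalIdealRing B] [Field L] [Algebra B L]
    [Algebra A B] [Algebra K L] [Algebra A L] [IsScalarTower A K L] [IsScalarTower A B L]
    [FiniteDimensional K L] [Algebra.IsSeparable K L] [IsIntegralClosure B A L] [IsFractionRing B L]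
    [Module.Free A B] [Module.Finite A B] :
    ∃ (n : ℕ) (t : B →ₗ[A] A) (b b' : Fin n → B),
      (∀ a : B, a = ∑ i, t (a * b' i) • b i) ∧ (∀ a : B, a = ∑ i, t (a * b i) • b' i) := by
  classical
  -- an `A`-basis of `B`, indexed by `Fin n`
  let I := Module.Free.ChooseBasisIndex A B
  let n := Fintype.card I
  let bB : Basis (Fin n) A B := (Module.Free.chooseBasis A B).reindex (Fintype.equivFin I)
  -- the induced `K`-basis of `L`
  haveI : IsLocalization (Algebra.algebraMapSubmonoid B A⁰) L :=
    IsIntegralClosure.isLocalization A K L B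
  let bL : Basis (Fin n) K L := bB.localizationLocalization K A⁰ L
  have hbL : ∀ i, bL i = algebraMap B L (bB i) := fun i =>
    bB.localizationLocalization_apply K A⁰ L i
  -- `(1 : Submodule B L)` restricted to `A` is the `A`-span of `bL`
  have h1 : (1 : Submodule B L).restrictScalars A = Submodule.span A (Set.range bL) := by
    rw [bB.localizationLocalization_span K A⁰ L]
    ext x
    simp only [Submodule.restrictScalars_mem, Submodule.mem_one, LinearMap.mem_range]
    constructor <;> rintro ⟨y, rfl⟩ <;> exact ⟨y, rfl⟩
  -- the trace dual of `1` is the `A`-span of the dual basis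
  have hdual : (Submodule.traceDual A K (1 : Submodule B L)).restrictScalars A =
      Submodule.span A (Set.range bL.traceDual) :=
    Submodule.traceDual_span_of_basis A (1 : Submodule B L) bL h1
  -- the inverse different is principal
  let D : FractionalIdeal B⁰ L := FractionalIdeal.dual A K 1
  have hD : (D : Submodule B L) = Submodule.traceDual A K (1 : Submodule B L) :=
    FractionalIdeal.coe_dual_one A K L B
  obtain ⟨δ, hδ⟩ := Submodule.IsPrincipal.principal (D : Submodule B L)
  -- membership facts
  have hmemD : ∀ x : L, x ∈ Submodule.traceDual A K (1 : Submodule B L) ↔ ∃ c : B, c • δ = x := by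
    intro x
    rw [← hD, hδ, Submodule.mem_span_singleton]
  have hδmem : δ ∈ Submodule.traceDual A K (1 : Submodule B L) := (hmemD δ).2 ⟨1, one_smul _ _⟩
  have h1mem : (1 : L) ∈ Submodule.traceDual A K (1 : Submodule B L) :=
    Submodule.one_le_traceDual_one (Submodule.one_le.mp le_rfl)
  obtain ⟨c₀, hc₀⟩ := (hmemD 1).1 h1mem
  have hδ0 : δ ≠ 0 := by
    rintro rfl
    rw [smul_zero] at hc₀
    exact zero_ne_one hc₀
  have hdual_mem : ∀ i, bL.traceDual i ∈ Submodule.traceDual A K (1 : Submodule B L) := by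
    intro i
    have : bL.traceDual i ∈ (Submodule.traceDual A K (1 : Submodule B L)).restrictScalars A := by
      rw [hdual]; exact Submodule.subset_span ⟨i, rfl⟩
    exact this
  choose c hc using fun i => (hmemD (bL.traceDual i)).1 (hdual_mem i)
  -- the functional `t(a) = Tr(δ a) ∈ A`
  have ht₀ : ∀ a : B, ∃ z : A, algebraMap A K z = Algebra.trace K L (δ * algebraMap B L a) := by
    intro a
    have := (Submodule.mem_traceDual.1 hδmem) (algebraMap B L a) (Submodule.mem_one.2 ⟨a, rfl⟩)
    obtain ⟨z, hz⟩ := RingHom.mem_range.1 this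
    exact ⟨z, by rw [hz, Algebra.traceForm_apply]⟩
  choose t₀ ht₀ using ht₀
  have hinjA : Function.Injective (algebraMap A K) := IsFractionRing.injective A K
  let t : B →ₗ[A] A :=
    { toFun := t₀
      map_add' := fun x y => hinjA (by
        rw [map_add, ht₀, ht₀, ht₀, map_add, mul_add, map_add])
      map_smul' := fun r x => hinjA (by
        rw [RingHom.id_apply, smul_eq_mul, (algebraMap A K).map_mul, ht₀, ht₀, Algebra.smul_def r x,
          (algebraMap B L).map_mul, ← IsScalarTower.algebraMap_apply A B L,
          IsScalarTower.algebraMap_apply A K L, mul_left_comm, ← Algebra.smul_def, LinearMap.map_smul,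
          smul_eq_mul]) }
  have ht : ∀ a : B, algebraMap A K (t a) = Algebra.trace K L (δ * algebraMap B L a) := ht₀
  have hinjB : Function.Injective (algebraMap B L) := IsIntegralClosure.algebraMap_injective B A L
  -- pushing `algebraMap B L` through an `A`-combination
  have hpush : ∀ (r : A) (y : B), algebraMap B L (r • y) = algebraMap A K r • algebraMap B L y := by
    intro r y
    rw [Algebra.smul_def, (algebraMap B L).map_mul, ← IsScalarTower.algebraMap_apply A B L,
      IsScalarTower.algebraMap_apply A K L, ← Algebra.smul_def]
  -- the two dual-basis expansions of an `x : L`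
  have hexp1 : ∀ x : L, ∑ i, Algebra.trace K L (x * bL.traceDual i) • bL i = x := by
    intro x
    conv_rhs => rw [← bL.sum_repr x]
    refine Finset.sum_congr rfl fun i _ => ?_
    have hrepr := bL.traceDual.traceDual_repr_apply x i
    rw [Module.Basis.traceDual_traceDual, Algebra.traceForm_apply] at hrepr
    rw [hrepr]
  have hexp2 : ∀ x : L, ∑ i, Algebra.trace K L (x * bL i) • bL.traceDual i = x := by
    intro x
    conv_rhs => rw [← bL.traceDual.sum_repr x]
    refine Finset.sum_congr rfl fun i _ => ?_
    rw [bL.traceDual_repr_apply x i, Algebra.traceForm_apply]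
  refine ⟨n, t, bB, c, fun a => hinjB ?_, fun a => hinjB ?_⟩
  · rw [map_sum]
    simp_rw [hpush, ht]
    conv_lhs => rw [← hexp1 (algebraMap B L a)]
    refine Finset.sum_congr rfl fun i _ => ?_
    rw [← hbL, ← hc i, Algebra.smul_def (c i) δ, (algebraMap B L).map_mul, mul_comm (algebraMap B L (c i)) δ,
      ← mul_assoc, mul_comm (algebraMap B L a) δ, mul_assoc]
  · rw [map_sum]
    simp_rw [hpush, ht]
    apply mul_left_cancel₀ hδ0
    rw [Finset.mul_sum]
    conv_lhs => rw [← hexp2 (δ * algebraMap B L a)]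
    refine Finset.sum_congr rfl fun i _ => ?_
    rw [mul_smul_comm, mul_comm δ (algebraMap B L (c i)), ← Algebra.smul_def (c i) δ, hc i,
      (algebraMap B L).map_mul, ← hbL, mul_assoc]

/-! ### §2. The unit ball `𝒪_E` of a finite `E/ℚ_p` inside `ℚ̄_p` -/

section UnitBall

open Literature.NumberTheory.Automorphic

variable (p : ℕ) [Fact p.Prime] (E : IntermediateField ℚ_[p] (PadicAlgCl p)) [FiniteDimensional ℚ_[p] E]

/-- **Frobenius data for `ℤ_p → 𝒪_E`**, `𝒪_E = PadicIntermediateField.unitBall p E` the ring of integers of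
a finite extension `E` of `ℚ_p` inside `ℚ̄_p` (the integral closure of `ℤ_p`, finite free over `ℤ_p`, a local
Dedekind domain hence a principal ideal domain — tree `PadicIntermediateFieldUnitBall`): §1 applied to
`(ℤ_p, ℚ_p, E, 𝒪_E)`. [cite: SerreLocalFields1979, Ch. III §3 (p. 50) and §2 Prop. 4] [cite: NeukirchANT1999, Ch. II (4.8)] -/
theorem exists_frobeniusData_unitBall :
    ∃ (n : ℕ) (t : PadicIntermediateField.unitBall p E →ₗ[ℤ_[p]] ℤ_[p])
      (b b' : Fin n → PadicIntermediateField.unitBall p E),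
      (∀ a, a = ∑ i, t (a * b' i) • b i) ∧ (∀ a, a = ∑ i, t (a * b i) • b' i) := by
  haveI : IsFractionRing (PadicIntermediateField.unitBall p E) E :=
    IsIntegralClosure.isFractionRing_of_finite_extension ℤ_[p] ℚ_[p] E
      (PadicIntermediateField.unitBall p E)
  haveI : IsPrincipalIdealRing (PadicIntermediateField.unitBall p E) :=
    PadicIntermediateField.isPrincipalIdealRing_unitBall p E
  exact exists_frobeniusData_of_isPrincipalIdealRing ℤ_[p] ℚ_[p] E
    (PadicIntermediateField.unitBall p E)

end UnitBall

end Literature.NumberTheory.EllipticCurves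

/-! ### §3. `𝒪 = GreenbergSelmer.padicCoeffIntegers ι`, the integers of `K = ℚ_p(ι K_g)` -/

namespace Literature.NumberTheory.EllipticCurves.GreenbergSelmer

open scoped MatrixGroups ModularForm
open CongruenceSubgroup Literature.NumberTheory.EllipticCurves.ModularForms
open Literature.NumberTheory.Automorphic

variable {Γ : Subgroup (GL (Fin 2) ℝ)} {k : ℤ} {g : CuspForm Γ k} {p : ℕ} [Fact p.Prime]
  (ι : coeffField g →+* PadicAlgCl p)

/-- **`K = ℚ_p(ι K_g)` is finite over `ℚ_p` when `K_g` is finite over `ℚ`**: `K ⊆ ℚ_p(ι b_1, …, ι b_d)` for a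
`ℚ`-basis `(b_j)` of `K_g`, finitely many algebraic generators (same argument as the tree's
`finiteDimensional_padicCoeffField_range_union_singleton`). [cite: Skinner2016PacificMC, §2.6 ("`L ⊂ ℚ̄_p` any finite extension of `ℚ_p` containing the image of `ℚ(f)`")] -/
theorem finiteDimensional_padicCoeffField [FiniteDimensional ℚ (coeffField g)] :
    FiniteDimensional ℚ_[p] (padicCoeffField ι) := by
  classical
  let b := Module.finBasis ℚ (coeffField g)
  let T : Set (PadicAlgCl p) := Set.range (fun i ↦ ι (b i))
  haveI : Finite T := (Set.finite_range _).to_subtype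
  have hT : FiniteDimensional ℚ_[p] (IntermediateField.adjoin ℚ_[p] T) :=
    IntermediateField.finiteDimensional_adjoin fun x _ ↦ Algebra.IsIntegral.isIntegral x
  have hle : padicCoeffField ι ≤ IntermediateField.adjoin ℚ_[p] T := by
    rw [padicCoeffField, IntermediateField.adjoin_le_iff]
    rintro x ⟨y, rfl⟩
    rw [← b.sum_repr y, map_sum]
    refine sum_mem fun i _ ↦ ?_
    rw [map_rat_smul, Rat.smul_def]
    exact mul_mem (SubfieldClass.ratCast_mem _ _)
      (IntermediateField.subset_adjoin ℚ_[p] T ⟨i, rfl⟩)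
  exact FiniteDimensional.of_injective (IntermediateField.inclusion hle).toLinearMap
    (IntermediateField.inclusion_injective hle)

/-- **`𝒪 = padicCoeffIntegers ι` IS the unit ball `𝒪_K = unitBall p (padicCoeffField ι)`**, as rings: both
have the elements `x ∈ K ⊆ ℚ̄_p` with `|x|_p ≤ 1` (the first as a subring of `K`, the second as a subring of
`ℚ̄_p`; `Valued.v x = ‖x‖₊`), and the isomorphism is the identity on `ℚ̄_p` and commutes with the two
structure maps from `ℤ_p` (`padicCoeffIntegers.ofPadicInt` resp. `ℤ_p → ℚ̄_p`) — two carriers of EPW's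
"`𝒪` the ring of integers of `K`". [cite: EmertonPollackWeston2006, §3.1 (p. 17)] [cite: NeukirchANT1999, Ch. II (4.8)] -/
theorem exists_ringEquiv_unitBall :
    ∃ e : padicCoeffIntegers ι ≃+* PadicIntermediateField.unitBall p (padicCoeffField ι),
      (∀ x, ((e x : PadicIntermediateField.unitBall p (padicCoeffField ι)) : PadicAlgCl p) =
        ((x : padicCoeffField ι) : PadicAlgCl p)) ∧
      ∀ z : ℤ_[p], e (algebraMap ℤ_[p] (padicCoeffIntegers ι) z) =
        algebraMap ℤ_[p] (PadicIntermediateField.unitBall p (padicCoeffField ι)) z := by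
  have hmem : ∀ x : padicCoeffIntegers ι,
      ((x : padicCoeffField ι) : PadicAlgCl p) ∈ PadicIntermediateField.unitBall p (padicCoeffField ι) := by
    intro x
    rw [PadicIntermediateField.mem_unitBall_iff]
    refine ⟨(x : padicCoeffField ι).2, ?_⟩
    rw [PadicAlgCl.valuation_def, ← NNReal.coe_le_coe, coe_nnnorm, NNReal.coe_one]
    exact x.2
  have hmem' : ∀ y : PadicIntermediateField.unitBall p (padicCoeffField ι),
      (⟨(y : PadicAlgCl p), PadicIntermediateField.mem_of_mem_unitBall p _ y.2⟩ : padicCoeffField ι) ∈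
        padicCoeffIntegers ι := by
    intro y
    rw [mem_padicCoeffIntegers_iff]
    have := PadicIntermediateField.valued_le_one_of_mem_unitBall p _ y.2
    rw [PadicAlgCl.valuation_def, ← NNReal.coe_le_coe, coe_nnnorm, NNReal.coe_one] at this
    exact this
  let e : padicCoeffIntegers ι ≃+* PadicIntermediateField.unitBall p (padicCoeffField ι) :=
    { toFun := fun x => ⟨((x : padicCoeffField ι) : PadicAlgCl p), hmem x⟩
      invFun := fun y =>
        ⟨⟨(y : PadicAlgCl p), PadicIntermediateField.mem_of_mem_unitBall p _ y.2⟩, hmem' y⟩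
      left_inv := fun x => rfl
      right_inv := fun y => rfl
      map_mul' := fun x y => rfl
      map_add' := fun x y => rfl }
  refine ⟨e, fun x => rfl, fun z => Subtype.ext ?_⟩
  have h1 : ((e (algebraMap ℤ_[p] (padicCoeffIntegers ι) z) : PadicAlgCl p)) =
      (((algebraMap ℤ_[p] (padicCoeffIntegers ι) z : padicCoeffIntegers ι) : padicCoeffField ι) :
        PadicAlgCl p) := rfl
  have h2 : ∀ x : ℚ_[p], ((algebraMap ℚ_[p] (padicCoeffField ι) x : padicCoeffField ι) : PadicAlgCl p) =
      algebraMap ℚ_[p] (PadicAlgCl p) x := fun x => by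
    rw [IsScalarTower.algebraMap_apply ℚ_[p] (padicCoeffField ι) (PadicAlgCl p)]
    rfl
  have h3 : ((algebraMap ℤ_[p] (PadicIntermediateField.unitBall p (padicCoeffField ι)) z :
      PadicIntermediateField.unitBall p (padicCoeffField ι)) : PadicAlgCl p) =
      algebraMap ℤ_[p] (PadicAlgCl p) z := rfl
  rw [h1, h3, padicCoeffIntegers.algebraMap_padicInt_eq, padicCoeffIntegers.coe_ofPadicInt, h2,
    IsScalarTower.algebraMap_apply ℤ_[p] ℚ_[p] (PadicAlgCl p)]
  rfl

/-- **The canonical `ℤ_p`-algebra isomorphism `𝒪 = padicCoeffIntegers ι ≃ₐ[ℤ_p] 𝒪_K = unitBall p K`**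
(identity on the underlying elements of `ℚ̄_p`) — two carriers of EPW's "`𝒪` the ring of integers of `K`".
[cite: EmertonPollackWeston2006, §3.1 (p. 17)] [cite: NeukirchANT1999, Ch. II (4.8)] -/
theorem exists_algEquiv_unitBall :
    ∃ e : padicCoeffIntegers ι ≃ₐ[ℤ_[p]] PadicIntermediateField.unitBall p (padicCoeffField ι),
      ∀ x, ((e x : PadicIntermediateField.unitBall p (padicCoeffField ι)) : PadicAlgCl p) =
        ((x : padicCoeffField ι) : PadicAlgCl p) := by
  obtain ⟨e, he, he'⟩ := exists_ringEquiv_unitBall ι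
  exact ⟨AlgEquiv.ofRingEquiv (f := e) he', he⟩

/-- **`ℤ_p → 𝒪` is injective** (`𝒪 ⊇ ℤ_p` is the ring of integers of an extension `K ⊇ ℚ_p`; `𝒪` is a faithful
`ℤ_p`-algebra). [cite: EmertonPollackWeston2006, §3.1 (p. 17)] [cite: NeukirchANT1999, Ch. II (4.8)] -/
theorem algebraMap_padicInt_injective :
    Function.Injective (algebraMap ℤ_[p] (padicCoeffIntegers ι)) := by
  intro a b h
  have h' := congrArg (fun x : padicCoeffIntegers ι => (x : padicCoeffField ι)) h
  simp only [padicCoeffIntegers.algebraMap_padicInt_eq, padicCoeffIntegers.coe_ofPadicInt] at h'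
  exact PadicInt.ext ((algebraMap ℚ_[p] (padicCoeffField ι)).injective h')

/-- `𝒪` is a FAITHFUL `ℤ_p`-algebra (as a theorem; use `haveI`). [cite: NeukirchANT1999, Ch. II (4.8)] -/
theorem faithfulSMul_padicInt : FaithfulSMul ℤ_[p] (padicCoeffIntegers ι) :=
  (faithfulSMul_iff_algebraMap_injective ℤ_[p] (padicCoeffIntegers ι)).2 (algebraMap_padicInt_injective ι)

variable [FiniteDimensional ℚ_[p] (padicCoeffField ι)]

/-- **`𝒪` is a principal ideal domain** (for `K/ℚ_p` finite; transported from `unitBall`: the ring of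
integers of a finite extension of `ℚ_p` is a discrete valuation ring). As a theorem; use `haveI`.
[cite: NeukirchANT1999, Ch. II (4.8)] [cite: SerreLocalFields1979, Ch. II §2 Prop. 3] -/
theorem isPrincipalIdealRing_padicCoeffIntegers : IsPrincipalIdealRing (padicCoeffIntegers ι) := by
  obtain ⟨e, -⟩ := exists_algEquiv_unitBall ι
  haveI := PadicIntermediateField.isPrincipalIdealRing_unitBall p (padicCoeffField ι)
  exact IsPrincipalIdealRing.of_surjective e.symm.toRingEquiv.toRingHom e.symm.surjective

/-- **`𝒪` is a finitely generated `ℤ_p`-module** (for `K/ℚ_p` finite). As a theorem; use `haveI`.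
[cite: NeukirchANT1999, Ch. II (6.8) with (4.8)] -/
theorem moduleFinite_padicCoeffIntegers : Module.Finite ℤ_[p] (padicCoeffIntegers ι) := by
  obtain ⟨e, -⟩ := exists_algEquiv_unitBall ι
  exact Module.Finite.equiv e.symm.toLinearEquiv

/-- **`𝒪` is a free `ℤ_p`-module** (for `K/ℚ_p` finite). As a theorem; use `haveI`.
[cite: NeukirchANT1999, Ch. II (6.8)] -/
theorem moduleFree_padicCoeffIntegers : Module.Free ℤ_[p] (padicCoeffIntegers ι) := by
  obtain ⟨e, -⟩ := exists_algEquiv_unitBall ι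
  exact Module.Free.of_equiv e.symm.toLinearEquiv

/-- **Frobenius data for `ℤ_p → 𝒪 = padicCoeffIntegers ι`** (`K = ℚ_p(ι K_g)` finite over `ℚ_p`): an
`ℤ_p`-linear form `t : 𝒪 → ℤ_p` and mutually `t`-dual `ℤ_p`-bases `b, b' : Fin n → 𝒪`,
`a = ∑ i, t (a * b' i) • b i = ∑ i, t (a * b i) • b' i` — EXACTLY the hypotheses `(t, b, b', hb, hb')` of the
Road-FF coefficient base change `CoeffBaseChange.exists_characterModule_baseChange_equiv` /
`…nonempty_characterModule_powerSeries_baseChange_equiv` for `R = ℤ_p`, `A = 𝒪_m` (equivalently: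
`Hom_{ℤ_p}(𝒪, ℤ_p)` is free of rank one over `𝒪`; the inverse different of `𝒪/ℤ_p` is principal).
[cite: SerreLocalFields1979, Ch. III §3 (p. 50) and §2 Prop. 4] -/
theorem exists_frobeniusData_padicCoeffIntegers :
    ∃ (n : ℕ) (t : padicCoeffIntegers ι →ₗ[ℤ_[p]] ℤ_[p]) (b b' : Fin n → padicCoeffIntegers ι),
      (∀ a, a = ∑ i, t (a * b' i) • b i) ∧ (∀ a, a = ∑ i, t (a * b i) • b' i) := by
  obtain ⟨e, -⟩ := exists_algEquiv_unitBall ι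
  obtain ⟨n, t, b, b', hb, hb'⟩ := exists_frobeniusData_unitBall p (padicCoeffField ι)
  refine ⟨n, t ∘ₗ e.toLinearMap, fun i => e.symm (b i), fun i => e.symm (b' i),
    fun a => e.injective ?_, fun a => e.injective ?_⟩
  · rw [map_sum]
    simp only [LinearMap.coe_comp, Function.comp_apply, AlgEquiv.toLinearMap_apply, map_smul, map_mul,
      AlgEquiv.apply_symm_apply]
    exact hb (e a)
  · rw [map_sum]
    simp only [LinearMap.coe_comp, Function.comp_apply, AlgEquiv.toLinearMap_apply, map_smul, map_mul,
      AlgEquiv.apply_symm_apply]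
    exact hb' (e a)

end Literature.NumberTheory.EllipticCurves.GreenbergSelmer

/-! ### §4. For a Hida member `g_m` (`Skinner2016.HidaCongruentForm`): its coefficient ring `𝒪_m` -/

namespace Literature.NumberTheory.EllipticCurves.Skinner2016.HidaCongruentForm

open Literature.NumberTheory.EllipticCurves.GreenbergSelmer
open Literature.NumberTheory.EllipticCurves.ModularForms

variable {W : WeierstrassCurve ℚ} [W.IsGloballyMinimal] {p : ℕ} [Fact p.Prime] {m : ℕ}
  (D : HidaCongruentForm W p m) [NeZero (W.conductorNorm ℤ / p)]

/-- **The member's `K_m = ℚ_p(ι_m K_{g_m})` is finite over `ℚ_p`**: `g_m` is a newform, so `K_{g_m}` is a number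
field (tree theorem `IsNewform0.finiteDimensional_coeffField_holds`, Shimura 1971 Thm. 3.48). As a theorem;
use `haveI`. [cite: Skinner2016PacificMC, §2.6 and §3.1 (a) ("`ℚ(f_m) ⊂ L`", `L/ℚ_p` finite)] -/
theorem finiteDimensional_padicCoeffField : FiniteDimensional ℚ_[p] (padicCoeffField D.ι) := by
  haveI : FiniteDimensional ℚ (coeffField D.g) :=
    IsNewform0.finiteDimensional_coeffField_holds D.isNewform
  exact GreenbergSelmer.finiteDimensional_padicCoeffField D.ι

/-- **Frobenius data for the member's coefficient extension `ℤ_p → 𝒪_m`** — the input "(Frob)" of the binder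
`e_m` of `P2.RoadFF.fittingCongruenceFrameTwoSlotAt_of_members_descent_le_printed` (via
`CoeffBaseChange.nonempty_characterModule_powerSeries_baseChange_equiv`). [cite: SerreLocalFields1979, Ch. III §3 (p. 50) and §2 Prop. 4] -/
theorem exists_frobeniusData :
    ∃ (n : ℕ) (t : padicCoeffIntegers D.ι →ₗ[ℤ_[p]] ℤ_[p]) (b b' : Fin n → padicCoeffIntegers D.ι),
      (∀ a, a = ∑ i, t (a * b' i) • b i) ∧ (∀ a, a = ∑ i, t (a * b i) • b' i) := by
  haveI := D.finiteDimensional_padicCoeffField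
  exact exists_frobeniusData_padicCoeffIntegers D.ι

/-- The member's coefficient ring `𝒪_m` is a principal ideal domain. [cite: NeukirchANT1999, Ch. II (4.8)] -/
theorem isPrincipalIdealRing_coeffRing : IsPrincipalIdealRing (padicCoeffIntegers D.ι) := by
  haveI := D.finiteDimensional_padicCoeffField
  exact isPrincipalIdealRing_padicCoeffIntegers D.ι

/-- The member's coefficient ring `𝒪_m` is a free `ℤ_p`-module. [cite: NeukirchANT1999, Ch. II (6.8)] -/
theorem moduleFree_coeffRing : Module.Free ℤ_[p] (padicCoeffIntegers D.ι) := by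
  haveI := D.finiteDimensional_padicCoeffField
  exact moduleFree_padicCoeffIntegers D.ι

/-- The member's coefficient ring `𝒪_m` is a finitely generated `ℤ_p`-module. [cite: NeukirchANT1999, Ch. II (6.8)] -/
theorem moduleFinite_coeffRing : Module.Finite ℤ_[p] (padicCoeffIntegers D.ι) := by
  haveI := D.finiteDimensional_padicCoeffField
  exact moduleFinite_padicCoeffIntegers D.ι

omit [NeZero (W.conductorNorm ℤ / p)] in
/-- `ℤ_p → 𝒪_m` is injective. [cite: Skinner2016PacificMC, §2.6 ("`𝒪` the ring of integers of `L`", `L ⊃ ℚ_p`)] -/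
theorem algebraMap_padicInt_injective :
    Function.Injective (algebraMap ℤ_[p] (padicCoeffIntegers D.ι)) :=
  GreenbergSelmer.algebraMap_padicInt_injective D.ι

end Literature.NumberTheory.EllipticCurves.Skinner2016.HidaCongruentForm

end
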